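import Summits.Ventures.CertifiedArithmetic.LowPrec.SRSaturationCompare
import Summits.Ventures.CertifiedArithmetic.LowPrec.SRSaturationTail
import Summits.Ventures.CertifiedArithmetic.LowPrec.SRSpacing
import HarnessLib

/-!
# Stochastic rounding into a finite format, XIII: envelopes WITHOUT the no-saturation hypothesis

HONEST FRAMING: certified error envelopes and provably optimal rounding/accumulation schemes for
low-precision formats under stated cost models; every table by two implementations; no hardware or
vendor claims.

The four files X–XIII remove the hypothesis `NoSatT` ("no branch of the outcome tree ever leaves the
representable hull") from the SR summation envelopes of files VI–IX, replacing it by a hypothesis on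
the DATA alone — headroom `h`: every exact partial sum of the summation tree lies in
`[−M + h, M − h]`, `M = max F` — at the price of an explicit, exponentially small saturation term.
For a finite format `F ⊆ [lo, hi]` containing `lo, hi`, with hull gap `≤ G` (`HullData`), and every
tree `T` with `HeadroomT lo hi h T`, `0 < h`:

* `satProbT_le_satBoundT_rat` — **P(saturation) ≤ satBoundT G h T ≤ 2(m−1)·e^{−2h²/((m−1)G²)}**;
* `prob_dev_ge_le_rat` — **tails**: `P_F(|ŝ_T − ∑| ≥ t) ≤ 2e^{−2t²/(mG²)} + satBoundT G h T`;
* `abs_treeBias_le_rat` — **bias**: `|E_F ŝ_T − ∑| ≤ 2R · satBoundT`, `R = max(hi − lo, mG)`;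
* `sq_err_le_rat` — **mean square**: `E_F(ŝ_T − ∑)² ≤ mG²/4 + R² · satBoundT`;
* `hullData_valueSet` + `format_*` — the same for EVERY minifloat format `φ` of the Literature
  model (`F = valueSet φ`, `lo/hi = ∓maxRat`, `G = 2^(emaxCode−1)·quantum`, subnormals included);
* kernel-checked FP4 instances agreeing with the two-implementation tables `certs/sr/gen4/SAT_*`.

Mechanism: `F` is coupled to its uniform refinement `F' = extendBy F lo hi G (m−1)` (file X′), which
agrees with `F` on the hull and cannot saturate under headroom; the two evaluations coincide until the
first exit (file X), the exit count in `F'` is a sum of node terms each bounded by Chernoff on two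
independent sub-Gaussian subtree values (file XII).

Numbers (honest scope). The saturation term is small iff `2h² ≳ (m−1)G²·log(2(m−1)/δ)`: with
`h/G = 1024` (half the range of a binary16-like finite format, `maxRat/G = 2047`) and `m = 4096`
terms in any order, `satBoundT ≤ 8190·e^{−512}`; for OCP E4M3 (`maxRat/G = 14`) with `h = maxRat/2`
the term is `≤ 8e^{−24.5} ≈ 2·10⁻¹⁰` at `m = 5` but `≈ 0.05` at `m = 16` and vacuous beyond: FP8
ACCUMULATORS saturate with non-negligible probability and only the exact finite certificates of files
IV/VIII apply there. No claim is made about any hardware's accumulator width.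
-/

namespace Summit.Ventures.CertifiedArithmetic.LowPrec.SR

open Literature.ComputerArithmetic.ConnollyHighamMary2021 Literature.ComputerArithmetic.FloatingPoint
open Finset Real STree

section Generic

variable {K : Type*} [Field K] [LinearOrder K] [IsStrictOrderedRing K]

/-- `F` agrees with its uniform refinement on the hull (file X′ ⇒ file X). -/
theorem agrees_extendBy (F : Finset K) {lo hi G : K} (hG : 0 < G)
    (hbd : ∀ y ∈ F, lo ≤ y ∧ y ≤ hi) (N : ℕ) : Agrees F (extendBy F lo hi G N) :=
  ⟨subset_extendBy F lo hi G N, fun _ hy hin => mem_of_mem_extendBy_of_inHull hG hbd hy hin⟩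

/-- The standing hypotheses on the format: `lo, hi ∈ F ⊆ [lo, hi]` and the gap between consecutive
values is at most `G > 0` everywhere on the hull. Every minifloat value set is one
(`hullData_valueSet`). -/
structure HullData (F : Finset K) (lo hi G : K) : Prop where
  /-- the bottom of the hull is a value -/
  lo_mem : lo ∈ F
  /-- the top of the hull is a value -/
  hi_mem : hi ∈ F
  /-- all values lie in `[lo, hi]` -/
  bounds : ∀ y ∈ F, lo ≤ y ∧ y ≤ hi
  /-- the gap bound is positive -/
  gap_pos : 0 < G
  /-- consecutive values are at most `G` apart -/
  gap_le : ∀ c, InHull F c → roundUp F c - roundDown F c ≤ G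

/-- Under headroom `h ≥ 0` the refinement with `N ≥ m − 1` layers neither saturates nor has a gap
above `G` along `T`. -/
theorem HullData.refine {F : Finset K} {lo hi G : K} (hB : HullData F lo hi G) {h : K} (hh : 0 ≤ h)
    {N : ℕ} {T : STree K} (hN : T.nodes ≤ N + 1) (hT : HeadroomT lo hi h T) :
    NoSatT (extendBy F lo hi G N) T ∧ GapLET (extendBy F lo hi G N) G T := by
  have hF' : (extendBy F lo hi G N).Nonempty := ⟨lo, subset_extendBy F lo hi G N hB.lo_mem⟩
  have hgap' : ∀ c, InHull (extendBy F lo hi G N) c →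
      roundUp (extendBy F lo hi G N) c - roundDown (extendBy F lo hi G N) c ≤ G :=
    fun c hc => gap_extendBy hB.gap_pos hB.lo_mem hB.hi_mem hB.bounds hB.gap_le c hc
  exact ⟨noSatT_of_roomT hF' hgap' (fun c h1 h2 => inHull_extendBy hB.lo_mem hB.hi_mem h1 h2) T
      (roomT_of_headroomT hh hB.gap_pos.le hN hT), gapLET_of_hull hF' hgap' T⟩

/-- Under headroom, both laws stay within `R = max(hi − lo, mG)` of the exact sum. -/
theorem HullData.allOut_both {F : Finset K} {lo hi G : K} (hB : HullData F lo hi G) {h : K}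
    (hh : 0 ≤ h) {N : ℕ} {T : STree K} (hN : T.nodes ≤ N + 1) (hT : HeadroomT lo hi h T) :
    AllOut F T (fun v => |v - T.exact| ≤ max (hi - lo) (T.nodes * G)) ∧
      AllOut (extendBy F lo hi G N) T (fun v => |v - T.exact| ≤ max (hi - lo) (T.nodes * G)) := by
  obtain ⟨hns, hgl⟩ := hB.refine hh hN hT
  exact ⟨allOut_mono F T (fun v hv => hv.trans (le_max_left _ _))
      (allOut_abs_sub_exact_le ⟨lo, hB.lo_mem⟩ hh hB.bounds hT),
    allOut_mono _ T (fun v hv => hv.trans (le_max_right _ _)) (allOut_abs_sub_le _ G T hns hgl)⟩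

/-- **Bias under headroom (exact-arithmetic form).** `|E_F ŝ_T − ∑| ≤ 2R · satProbT F T`. -/
theorem HullData.bias_le {F : Finset K} {lo hi G : K} (hB : HullData F lo hi G) {h : K}
    (hh : 0 ≤ h) (T : STree K) (hT : HeadroomT lo hi h T) :
    |treeBias F T| ≤ 2 * max (hi - lo) (T.nodes * G) * satProbT F T := by
  obtain ⟨hF, hF'⟩ := hB.allOut_both hh (N := T.nodes - 1) (by omega) hT
  have hR : 0 ≤ max (hi - lo) (T.nodes * G) :=
    le_max_of_le_right (mul_nonneg (Nat.cast_nonneg _) hB.gap_pos.le)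
  exact abs_treeBias_le (agrees_extendBy F hB.gap_pos hB.bounds _) T hR hF hF'
    (hB.refine hh (N := T.nodes - 1) (by omega) hT).1

/-- **Mean square under headroom (exact-arithmetic form).**
`E_F(ŝ_T − ∑)² ≤ mG²/4 + R² · satProbT F T`. -/
theorem HullData.sqErr_le {F : Finset K} {lo hi G : K} (hB : HullData F lo hi G) {h : K}
    (hh : 0 ≤ h) (T : STree K) (hT : HeadroomT lo hi h T) :
    treeExp F T (fun v => (v - T.exact) ^ 2)
      ≤ T.nodes * G ^ 2 / 4 + max (hi - lo) (T.nodes * G) ^ 2 * satProbT F T := by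
  obtain ⟨hF, hF'⟩ := hB.allOut_both hh (N := T.nodes - 1) (by omega) hT
  obtain ⟨hns, hgl⟩ := hB.refine hh (N := T.nodes - 1) (by omega) hT
  have h1 := abs_sq_sub_treeVar_le (agrees_extendBy F hB.gap_pos hB.bounds _) T hF hF' hns
  have h2 := treeVar_le (extendBy F lo hi G (T.nodes - 1)) G T hgl
  rw [abs_le] at h1
  linarith [h1.2]

end Generic

/-! ### Over `ℚ`, with the real-analytic saturation term -/

/-- **P(SATURATION) IS EXPONENTIALLY SMALL UNDER HEADROOM.** For a format with `HullData F lo hi G`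
and a tree whose exact partial sums keep headroom `h > 0`:
`P_F(some rounding of T saturates) ≤ satBoundT G h T` (`≤ 2(m−1)e^{−2h²/((m−1)G²)}`, `satBoundT_le`). -/
theorem satProbT_le_satBoundT_rat {F : Finset ℚ} {lo hi G : ℚ} (hB : HullData F lo hi G) {h : ℚ}
    (hh : 0 < h) (T : STree ℚ) (hT : HeadroomT lo hi h T) :
    ((satProbT F T : ℚ) : ℝ) ≤ satBoundT (G : ℝ) h T := by
  set F' := extendBy F lo hi G (T.nodes - 1) with hF'
  obtain ⟨hns, hgl⟩ := hB.refine hh.le (N := T.nodes - 1) (T := T) (by omega) hT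
  have h1 : satProbT F T ≤ satProb F' F T :=
    satProbT_le_satProb (agrees_extendBy F hB.gap_pos hB.bounds _) T
  have h2 : ((satProb F' F T : ℚ) : ℝ) ≤ satBoundT (G : ℝ) h T := by
    rw [← satProb_cast, ← satBoundT_map ((↑) : ℚ → ℝ) (G : ℝ) h T]
    refine satProb_le_satBoundT (realImage F') (realImage F) (G : ℝ) (lo := (lo : ℝ))
      (hi := (hi : ℝ)) (by exact_mod_cast hh) ?_ _ ((noSatT_cast F' T).mpr hns)
      ((gapLET_cast F' G T).mpr hgl) ((headroomT_cast lo hi h T).mpr hT)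
    intro c hc1 hc2
    exact ⟨⟨(lo : ℝ), cast_mem_realImage.mpr hB.lo_mem, hc1⟩,
      ⟨(hi : ℝ), cast_mem_realImage.mpr hB.hi_mem, hc2⟩⟩
  calc ((satProbT F T : ℚ) : ℝ) ≤ ((satProb F' F T : ℚ) : ℝ) := by exact_mod_cast h1
    _ ≤ _ := h2

/-- **TAILS WITHOUT THE NO-SATURATION HYPOTHESIS.** Under headroom `h > 0`, for every `t > 0`,
`P_F(|ŝ_T − ∑ leaves| ≥ t) ≤ 2e^{−2t²/(m G²)} + satBoundT G h T`. -/
theorem prob_dev_ge_le_rat {F : Finset ℚ} {lo hi G : ℚ} (hB : HullData F lo hi G) {h : ℚ}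
    (hh : 0 < h) (T : STree ℚ) (hT : HeadroomT lo hi h T) (t : ℚ) (ht : 0 < t) :
    ((treeExp F T (devInd t T.exact) : ℚ) : ℝ)
      ≤ 2 * exp (-2 * (t : ℝ) ^ 2 / (T.nodes * (G : ℝ) ^ 2)) + satBoundT (G : ℝ) h T := by
  obtain ⟨hns, hgl⟩ := hB.refine hh.le (N := T.nodes - 1) (T := T) (by omega) hT
  have hf : ∀ v, 0 ≤ devInd t T.exact v ∧ devInd t T.exact v ≤ 1 := fun v => by
    unfold devInd; split_ifs <;> norm_num
  have h1 := treeExp_le_add_satProbT (agrees_extendBy F hB.gap_pos hB.bounds (T.nodes - 1)) T hf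
  have h2 := tree_prob_dev_ge_le_exp_rat (extendBy F lo hi G (T.nodes - 1)) G T hns hgl t ht
  have h3 := satProbT_le_satBoundT_rat hB hh T hT
  calc ((treeExp F T (devInd t T.exact) : ℚ) : ℝ)
      ≤ ((treeExp (extendBy F lo hi G (T.nodes - 1)) T (devInd t T.exact) : ℚ) : ℝ)
        + ((satProbT F T : ℚ) : ℝ) := by exact_mod_cast h1
    _ ≤ _ := add_le_add h2 h3

/-- **BIAS WITHOUT THE NO-SATURATION HYPOTHESIS.** `|E_F ŝ_T − ∑| ≤ 2R · satBoundT G h T`,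
`R = max(hi − lo, mG)` (saturation is the ONLY source of bias, file VI; here it is quantified). -/
theorem abs_treeBias_le_rat {F : Finset ℚ} {lo hi G : ℚ} (hB : HullData F lo hi G) {h : ℚ}
    (hh : 0 < h) (T : STree ℚ) (hT : HeadroomT lo hi h T) :
    ((|treeBias F T| : ℚ) : ℝ)
      ≤ 2 * ((max (hi - lo) (T.nodes * G) : ℚ) : ℝ) * satBoundT (G : ℝ) h T := by
  have h1 := hB.bias_le hh.le T hT
  have h2 := satProbT_le_satBoundT_rat hB hh T hT
  have hR : (0 : ℝ) ≤ 2 * ((max (hi - lo) (T.nodes * G) : ℚ) : ℝ) := by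
    have : (0 : ℚ) ≤ max (hi - lo) (T.nodes * G) :=
      le_max_of_le_right (mul_nonneg (Nat.cast_nonneg _) hB.gap_pos.le)
    positivity
  calc ((|treeBias F T| : ℚ) : ℝ)
      ≤ ((2 * max (hi - lo) (T.nodes * G) * satProbT F T : ℚ) : ℝ) := by exact_mod_cast h1
    _ = 2 * ((max (hi - lo) (T.nodes * G) : ℚ) : ℝ) * ((satProbT F T : ℚ) : ℝ) := by push_cast; ring
    _ ≤ _ := mul_le_mul_of_nonneg_left h2 hR

/-- **MEAN SQUARE WITHOUT THE NO-SATURATION HYPOTHESIS.** `E_F(ŝ_T − ∑)² ≤ mG²/4 + R²·satBoundT`. -/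
theorem sq_err_le_rat {F : Finset ℚ} {lo hi G : ℚ} (hB : HullData F lo hi G) {h : ℚ}
    (hh : 0 < h) (T : STree ℚ) (hT : HeadroomT lo hi h T) :
    ((treeExp F T (fun v => (v - T.exact) ^ 2) : ℚ) : ℝ)
      ≤ T.nodes * (G : ℝ) ^ 2 / 4
        + ((max (hi - lo) (T.nodes * G) : ℚ) : ℝ) ^ 2 * satBoundT (G : ℝ) h T := by
  have h1 := hB.sqErr_le hh.le T hT
  have h2 := satProbT_le_satBoundT_rat hB hh T hT
  have hR : (0 : ℝ) ≤ ((max (hi - lo) (T.nodes * G) : ℚ) : ℝ) ^ 2 := sq_nonneg _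
  calc ((treeExp F T (fun v => (v - T.exact) ^ 2) : ℚ) : ℝ)
      ≤ ((T.nodes * G ^ 2 / 4 + max (hi - lo) (T.nodes * G) ^ 2 * satProbT F T : ℚ) : ℝ) := by
        exact_mod_cast h1
    _ = T.nodes * (G : ℝ) ^ 2 / 4
        + ((max (hi - lo) (T.nodes * G) : ℚ) : ℝ) ^ 2 * ((satProbT F T : ℚ) : ℝ) := by
        push_cast; ring
    _ ≤ _ := by nlinarith

/-! ### Every minifloat format -/

/-- The top-binade spacing `2^(emaxCode − 1) · quantum` of a format: the largest gap. -/
def topGap (φ : Format) : ℚ := 2 ^ (φ.emaxCode - 1) * φ.quantum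

/-- **Every minifloat value set satisfies the standing hypotheses** with `lo/hi = ∓maxRat` and
`G = topGap` (subnormals, the top code convention `topMan`, everything included). -/
theorem hullData_valueSet (φ : Format) :
    HullData (MiniFloat.valueSet φ) (-φ.maxRat) φ.maxRat (topGap φ) where
  lo_mem := MiniFloat.neg_maxRat_mem_valueSet φ
  hi_mem := MiniFloat.maxRat_mem_valueSet φ
  bounds := fun y hy => abs_le.mp ((valueSet_inHull_iff φ y).mp ⟨⟨y, hy, le_rfl⟩, ⟨y, hy, le_rfl⟩⟩)
  gap_pos := mul_pos (pow_pos (by norm_num) _) φ.quantum_pos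
  gap_le := fun _ hc => valueSet_gap_le_top φ hc

/-- **Every format, any order: P(saturation) under headroom.** -/
theorem format_satProbT_le (φ : Format) {h : ℚ} (hh : 0 < h) (T : STree ℚ)
    (hT : HeadroomT (-φ.maxRat) φ.maxRat h T) :
    ((satProbT (MiniFloat.valueSet φ) T : ℚ) : ℝ) ≤ satBoundT (topGap φ : ℝ) h T :=
  satProbT_le_satBoundT_rat (hullData_valueSet φ) hh T hT

/-- **Every format, any order: tails under headroom, no other hypothesis.** -/
theorem format_prob_dev_ge_le (φ : Format) {h : ℚ} (hh : 0 < h) (T : STree ℚ)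
    (hT : HeadroomT (-φ.maxRat) φ.maxRat h T) (t : ℚ) (ht : 0 < t) :
    ((treeExp (MiniFloat.valueSet φ) T (devInd t T.exact) : ℚ) : ℝ)
      ≤ 2 * exp (-2 * (t : ℝ) ^ 2 / (T.nodes * (topGap φ : ℝ) ^ 2)) + satBoundT (topGap φ : ℝ) h T :=
  prob_dev_ge_le_rat (hullData_valueSet φ) hh T hT t ht

/-- **Every format, any order: the bias of SR summation under headroom.** -/
theorem format_abs_treeBias_le (φ : Format) {h : ℚ} (hh : 0 < h) (T : STree ℚ)
    (hT : HeadroomT (-φ.maxRat) φ.maxRat h T) :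
    ((|treeBias (MiniFloat.valueSet φ) T| : ℚ) : ℝ)
      ≤ 2 * ((max (φ.maxRat - -φ.maxRat) (T.nodes * topGap φ) : ℚ) : ℝ)
        * satBoundT (topGap φ : ℝ) h T :=
  abs_treeBias_le_rat (hullData_valueSet φ) hh T hT

/-- **Every format, any order: mean square error under headroom.** -/
theorem format_sq_err_le (φ : Format) {h : ℚ} (hh : 0 < h) (T : STree ℚ)
    (hT : HeadroomT (-φ.maxRat) φ.maxRat h T) :
    ((treeExp (MiniFloat.valueSet φ) T (fun v => (v - T.exact) ^ 2) : ℚ) : ℝ)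
      ≤ T.nodes * (topGap φ : ℝ) ^ 2 / 4
        + ((max (φ.maxRat - -φ.maxRat) (T.nodes * topGap φ) : ℚ) : ℝ) ^ 2
          * satBoundT (topGap φ : ℝ) h T :=
  sq_err_le_rat (hullData_valueSet φ) hh T hT

/-! ### Kernel-checked FP4 instances (rows of `certs/sr/gen4/SAT_e2m1_seq3_{A,B}.csv`) -/

/-- `((4 ⊕ 3/2) ⊕ 3/2)` in E2M1: `5.5` rounds up to `6` with probability `3/4`, and then `7.5`
leaves the hull: P(saturation) `= 3/4` (table row `4,3/2,3/2`). -/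
example : satProbT FP4.e2m1 (.node (.node (.leaf 4) (.leaf (3/2))) (.leaf (3/2))) = 3/4 := by
  decide +kernel

/-- Same row: the bias is `E ŝ − 7 = −9/8` (`= treeBias`, file VI `treeExp_id`). -/
example : treeBias FP4.e2m1 (.node (.node (.leaf 4) (.leaf (3/2))) (.leaf (3/2))) = -9/8 := by
  decide +kernel

/-- Same row: the mean square error is `3/2`. -/
example : treeExp FP4.e2m1 (.node (.node (.leaf 4) (.leaf (3/2))) (.leaf (3/2)))
    (fun v => (v - 7) ^ 2) = 3/2 := by
  decide +kernel

/-- A tree with headroom `2` in E2M1 (`[−6, 6]`): partial sums `3/2, 4` lie in `[−4, 4]`. -/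
example : HeadroomT (-6 : ℚ) 6 2 (.node (.node (.leaf 2) (.leaf (-1/2))) (.leaf (5/2))) := by
  decide +kernel

/-- … and it saturates with probability `0` (table `SATH_e2m1_seq3`: every `h ≥ 2` row is `0`). -/
example : satProbT FP4.e2m1 (.node (.node (.leaf 2) (.leaf (-1/2))) (.leaf (5/2))) = 0 := by
  decide +kernel

end Summit.Ventures.CertifiedArithmetic.LowPrec.SR
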